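import Summits.QuantumFields.YangMills.Theorems.SwapVirialDeficitOddSectorExplicitGap
import Summits.QuantumFields.YangMills.Theorems.SwapVirialDeficitSwapRingLogDerivDeficit
import HarnessLib

/-!
# The odd σ-sectors satisfy the per-sector virial window row trivially, uniformly in `L`

fcl-p3 g46's D2 phrases ⟨24197⟩'s window row as `VirialWindow`: `Σ_z (½K_L⟪W⟫_{z,β} − βK_L⟪R⟫_{z,β}) ≤ (1/2 − c)·Σ_z Z_z(β)` on `L ≤ β^a`;
by ✓`virial_ring`, `½K_L⟪W⟫_z − bK_L⟪R⟫_z = (9L⁴ − 1)·Z_z(b) − b·E_z(b)` for EVERY sector `z`.  For the four ODD sectors (`z 0 ≠ z 1`) this combination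
is `≤ 0` on a polynomial window, from fcl-p3 g43's uniform explicit gap ✓`swap_oddSector_void_uniform` (`μ_L{F^S_z ≤ u} = 0` for `u < (1248L³)⁻²`):

* `ae_oddSector_gap_le` (`F^S_z ≥ (1248L³)⁻²` a.e., countable union of the null sublevel sets),
* ★★ `oddSector_gap_mul_laplace_le_meanDeficit` — `(1248L³)⁻²·Z_z(b) ≤ E_z(b)` for every real `b`, every `L`,
* ★★★ `oddSector_virialWindow` ∕ `oddSector_virialWindow_nine` — `α·Z_z(b) − b·E_z(b) ≤ 0` whenever `b ≥ α·(1248L³)²` (`α ≥ 0`; `α = 9L⁴ − 1`):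
  the odd sectors' share of `VirialWindow` is NON-POSITIVE on the polynomial window `b ≥ (9L⁴ − 1)(1248L³)²`, uniformly in `L`.

HONEST LABEL: four of eight sectors of one inequality; the principal class `{000, 110}` (leaders' valley term, remainder) and the two `z 2 = 1` sectors are
untouched; `VirialWindow` ∕ ⟨24197⟩ (window-uniform) OPEN; ⟨24194⟩ ∕ ⟨24497⟩ OPEN; own crux ⟨22884⟩ OPEN (blocked-on ⟨19935⟩); no crux, rung of record or
summit is proved; the Yang–Mills mass gap is NOT proved; no summit is proved by a line.  THEOREMS ONLY (0 `def`, 0 `sorry`), standard axioms.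
Width seat ym-line-sfw-p2-w2 g57 (cell ym-idea-1, free hands), `--supports stmt-QuantumFields-24197`.  References: [cite: tHooft1979]; [cite: Luscher1983, §2]; [folklore].
-/

set_option autoImplicit false

noncomputable section

open MeasureTheory Set Filter
open scoped BigOperators
open Literature.MathematicalPhysics.QuantumFieldTheory hiding SU2
open Literature.MathematicalPhysics.QuantumLattice

namespace Summit.QuantumFields.YangMills.Theorems.SwapVirialDeficit.SwapRing

open Summit.QuantumFields.YangMills.Theorems.FemtoTransferGap
open Summit.QuantumFields.YangMills.Theorems.FemtoTransferGap.TT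
open Summit.QuantumFields.YangMills.Theorems.VirialFluxGap.RingDeficit
open Summit.QuantumFields.YangMills.Theorems.SwapVirialDeficit.OddSectorGap (swap_oddSector_void_uniform)

variable {L : ℕ} [NeZero L]

/-- In an odd sector (`z 0 ≠ z 1`), almost every ring configuration has deficit `≥ (1248·L³)⁻²` (✓`swap_oddSector_void_uniform`). [cite: tHooft1979] -/
theorem ae_oddSector_gap_le (z : Fin 3 → Bool) (hz : z 0 ≠ z 1) :
    ∀ᵐ P ∂(ringMeasure L), ((1248 * (L : ℝ) ^ 3) ^ 2)⁻¹ ≤ swapRingDeficit L z P := by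
  haveI := isProbabilityMeasure_ringMeasure (L := L)
  have hL : (0 : ℝ) < (L : ℝ) := Nat.cast_pos.2 (NeZero.pos L)
  have hg : 0 < ((1248 * (L : ℝ) ^ 3) ^ 2)⁻¹ := by positivity
  -- the sublevel sets `{F ≤ g·(1 − 1/(n+2))}` are null; their union is `{F < g}`
  have hnull : ∀ n : ℕ, (ringMeasure L) {P | swapRingDeficit L z P ≤ ((1248 * (L : ℝ) ^ 3) ^ 2)⁻¹ * (1 - 1 / ((n : ℝ) + 2))} = 0 := fun n => by
    have hlt : ((1248 * (L : ℝ) ^ 3) ^ 2)⁻¹ * (1 - 1 / ((n : ℝ) + 2)) < ((1248 * (L : ℝ) ^ 3) ^ 2)⁻¹ := by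
      have : 0 < 1 / ((n : ℝ) + 2) := by positivity
      nlinarith
    have h := swap_oddSector_void_uniform (L := L) z hz hlt
    exact (measureReal_eq_zero_iff (measure_ne_top _ _)).1 h
  have hU : (ringMeasure L) (⋃ n : ℕ, {P | swapRingDeficit L z P ≤ ((1248 * (L : ℝ) ^ 3) ^ 2)⁻¹ * (1 - 1 / ((n : ℝ) + 2))}) = 0 :=
    measure_iUnion_null hnull
  rw [ae_iff]
  refine measure_mono_null (fun P hP => ?_) hU
  simp only [Set.mem_setOf_eq, not_le] at hP
  simp only [Set.mem_iUnion, Set.mem_setOf_eq]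
  -- choose `n` with `g/(n+2) ≤ g − F`
  obtain ⟨n, hn⟩ := exists_nat_gt (((1248 * (L : ℝ) ^ 3) ^ 2)⁻¹ / (((1248 * (L : ℝ) ^ 3) ^ 2)⁻¹ - swapRingDeficit L z P))
  refine ⟨n, ?_⟩
  have hd : 0 < ((1248 * (L : ℝ) ^ 3) ^ 2)⁻¹ - swapRingDeficit L z P := by linarith
  have hn2 : ((1248 * (L : ℝ) ^ 3) ^ 2)⁻¹ / (((1248 * (L : ℝ) ^ 3) ^ 2)⁻¹ - swapRingDeficit L z P) < (n : ℝ) + 2 := by linarith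
  rw [div_lt_iff₀ hd] at hn2
  have hn0 : (0 : ℝ) < (n : ℝ) + 2 := by positivity
  rw [mul_sub, mul_one, mul_one_div]
  have : ((1248 * (L : ℝ) ^ 3) ^ 2)⁻¹ / ((n : ℝ) + 2) ≤ ((1248 * (L : ℝ) ^ 3) ^ 2)⁻¹ - swapRingDeficit L z P := by
    rw [div_le_iff₀ hn0]; linarith
  linarith

/-- ★★ **ODD SECTORS: MEAN DEFICIT FLOOR, UNIFORM IN `L`**: for `z 0 ≠ z 1`, every `L ≥ 1`, every real `b`,
`(1248·L³)⁻²·Z_z(b) ≤ E_z(b)`, `Z_z(b) = ∫ e^{−bF^S_z} dμ_L`, `E_z(b) = ∫ F^S_z e^{−bF^S_z} dμ_L`. [cite: tHooft1979] [cite: Luscher1983, §2] -/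
theorem oddSector_gap_mul_laplace_le_meanDeficit (z : Fin 3 → Bool) (hz : z 0 ≠ z 1) (b : ℝ) :
    ((1248 * (L : ℝ) ^ 3) ^ 2)⁻¹ * ∫ P, Real.exp (-(b * swapRingDeficit L z P)) ∂(ringMeasure L) ≤
      ∫ P, swapRingDeficit L z P * Real.exp (-(b * swapRingDeficit L z P)) ∂(ringMeasure L) := by
  rw [← integral_const_mul]
  refine integral_mono_ae ((integrable_exp_swapDeficit z b).const_mul _) (integrable_swapDeficit_mul_exp z b) ?_
  filter_upwards [ae_oddSector_gap_le (L := L) z hz] with P hP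
  exact mul_le_mul_of_nonneg_right hP (Real.exp_pos _).le

/-- ★★★ **THE ODD SECTORS SATISFY THE PER-SECTOR VIRIAL WINDOW ROW TRIVIALLY**: for `z 0 ≠ z 1`, every `L ≥ 1`, every `α` and every
`b ≥ α·(1248·L³)²`: `α·Z_z(b) − b·E_z(b) ≤ 0`.  With ✓`virial_ring` (`bE_z = (9L⁴−1)Z_z − ½K_L⟪W⟫_z + bK_L⟪R⟫_z`) at `α = 9L⁴ − 1` this reads
`½K_L⟪W⟫_{z,b} − bK_L⟪R⟫_{z,b} ≤ 0 ≤ (1/2 − c)·Z_z(b)` on the polynomial window `b ≥ (9L⁴ − 1)(1248L³)²` — four of the eight sectors of D2's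
`VirialWindow` discharged uniformly in `L`. [cite: tHooft1979] [cite: Luscher1983, §2] -/
theorem oddSector_virialWindow (z : Fin 3 → Bool) (hz : z 0 ≠ z 1) {α b : ℝ} (hα : 0 ≤ α) (hb : α * (1248 * (L : ℝ) ^ 3) ^ 2 ≤ b) :
    α * ∫ P, Real.exp (-(b * swapRingDeficit L z P)) ∂(ringMeasure L) - b * ∫ P, swapRingDeficit L z P * Real.exp (-(b * swapRingDeficit L z P)) ∂(ringMeasure L) ≤ 0 := by
  haveI := isProbabilityMeasure_ringMeasure (L := L)
  have hL : (0 : ℝ) < (L : ℝ) := Nat.cast_pos.2 (NeZero.pos L)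
  have hA : 0 < (1248 * (L : ℝ) ^ 3) ^ 2 := by positivity
  have hZ : 0 ≤ ∫ P, Real.exp (-(b * swapRingDeficit L z P)) ∂(ringMeasure L) := integral_nonneg fun P => (Real.exp_pos _).le
  have h := oddSector_gap_mul_laplace_le_meanDeficit (L := L) z hz b
  have hb0 : 0 ≤ b := le_trans (by positivity) hb
  -- `α·Z ≤ b·(1248L³)⁻²·Z ≤ b·E`
  have h1 : α * ∫ P, Real.exp (-(b * swapRingDeficit L z P)) ∂(ringMeasure L) ≤
      b * (((1248 * (L : ℝ) ^ 3) ^ 2)⁻¹ * ∫ P, Real.exp (-(b * swapRingDeficit L z P)) ∂(ringMeasure L)) := by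
    rw [← mul_assoc]
    refine mul_le_mul_of_nonneg_right ?_ hZ
    rw [← div_eq_mul_inv, le_div_iff₀ hA]
    exact hb
  nlinarith [mul_le_mul_of_nonneg_left h hb0]

/-- The same in the crux's normalisation `α = 9L⁴ − 1` (then `b ≥ (9L⁴ − 1)(1248L³)²` suffices; e.g. every `b ≥ 1.5·10⁷·L^{10}`). [cite: tHooft1979] -/
theorem oddSector_virialWindow_nine (z : Fin 3 → Bool) (hz : z 0 ≠ z 1) {b : ℝ} (hb : (9 * (L : ℝ) ^ 4 - 1) * (1248 * (L : ℝ) ^ 3) ^ 2 ≤ b) :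
    (9 * (L : ℝ) ^ 4 - 1) * ∫ P, Real.exp (-(b * swapRingDeficit L z P)) ∂(ringMeasure L) -
        b * ∫ P, swapRingDeficit L z P * Real.exp (-(b * swapRingDeficit L z P)) ∂(ringMeasure L) ≤ 0 := by
  have hL : (1 : ℝ) ≤ (L : ℝ) := by exact_mod_cast NeZero.one_le
  have h9 : (0 : ℝ) ≤ 9 * (L : ℝ) ^ 4 - 1 := by nlinarith [one_le_pow₀ (n := 4) hL]
  exact oddSector_virialWindow z hz h9 hb

end Summit.QuantumFields.YangMills.Theorems.SwapVirialDeficit.SwapRing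

end
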